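import Mathlib
import Literature.Topology.PlaneTopology.Janiszewski
import Literature.Topology.PlaneTopology.EilenbergCriterion
import Literature.Probability.RandomPlanarGeometry.JordanDomainInterior
import Literature.Probability.RandomPlanarGeometry.CurveSpace
import HarnessLib

/-!
# An arc from the boundary does not separate a Jordan domain (domain bookkeeping D1)

Crux `AxiomsOfLimit` (stmt-CriticalPhenomena-1370), line `registered`, stub `stub_markovOfLimit`,
domain-bookkeeping step D1 of the Markov clause (lead c4): "an arc from the boundary does not
separate a Jordan domain". Theorems only.

Let `D` be a Jordan domain with boundary Jordan curve `J = frontier D` and let `γ : [0, 1] → ℂ`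
be an injective curve with `γ t ∈ D` for every `t ≠ 0` (in the application `γ 0 ∈ J`, a
"typical proper past" of the Markov clause: a simple arc from the marked boundary point into the
domain). Then `D ∖ γ[0, 1]` is connected, so that the remaining domain of such a past is the
whole slit domain.

Proof (Janiszewski). Put `K = γ[0, 1]`, a Jordan arc, so `ℂ ∖ K` is connected
(`Literature.Topology.PlaneTopology.JordanArcSeparation_holds`). The compact sets `J` and `K`
meet in at most the single point `γ 0` (the other points of `K` lie in the open set `D`, which
misses its frontier). Two points `x, y ∈ D ∖ K` are separated neither by `J` (they lie in the
connected set `D ⊆ ℂ ∖ J`) nor by `K`; by Janiszewski's theorem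
(`Literature.Topology.PlaneTopology.janiszewski`) they are not separated by `J ∪ K`: `y` lies in
the component `C` of `x` in `ℂ ∖ (J ∪ K)`. That component is a connected set containing
`x ∈ D` and missing `J = frontier D`, hence it stays inside `D`
(`JordanDomain.inter_frontier_nonempty_of_isPreconnected`); so `D ∖ K = C` is connected.
Nonemptiness of `D ∖ K`: otherwise `closure D ⊆ K`, so the Jordan curve `J` would be contained
in `J ∩ K ⊆ {γ 0}`, but `J` has two distinct points `D.boundary 0 ≠ D.boundary (1/2)`.

* `stub_arcComplementConnected` — the registered signature.

Sources: Ch. Pommerenke, *Boundary Behaviour of Conformal Maps* (1992), §1.1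
(Janiszewski's theorem); M. H. A. Newman, *Elements of the topology of plane sets of points*
(1951), Ch. V.
All `[folklore]`. Not here: the configuration rigidity / slit-not-Jordan consequences (separate
stubs of the same line).
-/

noncomputable section

open Set Topology

namespace Summit.CriticalPhenomena.SAWScalingLimit.Theorems.AxiomsOfLimitMarkov

open Literature.Probability.RandomPlanarGeometry Literature.Topology.PlaneTopology

/-- An open set misses its frontier: the carrier of a Jordan domain lies in the complement of
its boundary curve. [folklore] -/
theorem carrier_subset_compl_frontier (D : JordanDomain) :
    D.carrier ⊆ (frontier D.carrier)ᶜ := fun z hz hzJ =>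
  (eq_empty_iff_forall_notMem.1 D.isOpen.inter_frontier_eq z) ⟨hz, hzJ⟩

/-- The range of an injective curve in `ℂ` is a Jordan arc: it is homeomorphic to `[0, 1]`
(a continuous injection of a compact space into a Hausdorff space is an embedding).
[folklore] -/
theorem nonempty_homeomorph_range_of_injective (γ : Curve ℂ) (hγ : Function.Injective γ) :
    Nonempty (unitInterval ≃ₜ γ.range) :=
  ⟨(γ.continuous.isClosedEmbedding hγ).isEmbedding.toHomeomorph⟩

/-- The complement of (the range of) an injective curve in `ℂ` is connected — the
separation theorem for Jordan arcs (`JordanArcSeparation_holds`). [folklore] -/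
theorem isConnected_compl_range_of_injective (γ : Curve ℂ) (hγ : Function.Injective γ) :
    IsConnected γ.rangeᶜ :=
  JordanArcSeparation_holds _ (nonempty_homeomorph_range_of_injective γ hγ)

/-- If all points `γ t`, `t ≠ 0`, of a curve lie in the (open) carrier of a Jordan domain, the
curve meets the boundary curve at most in `γ 0`. [folklore] -/
theorem frontier_inter_range_subset_singleton (D : JordanDomain) (γ : Curve ℂ)
    (hin : ∀ t : unitInterval, t ≠ 0 → γ t ∈ D.carrier) :
    frontier D.carrier ∩ γ.range ⊆ {γ 0} := by
  rintro z ⟨hzJ, hzK⟩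
  obtain ⟨t, rfl⟩ := Curve.mem_range.1 hzK
  by_cases ht : t = 0
  · rw [ht]
    exact mem_singleton _
  · exact absurd hzJ (carrier_subset_compl_frontier D (hin t ht))

/-- If all points `γ t`, `t ≠ 0`, of a curve lie in the carrier of a Jordan domain `D`, then
`D ∖ γ[0, 1]` is nonempty: otherwise `frontier D ⊆ closure D ⊆ γ[0, 1]` would force the
boundary Jordan curve into the single point `γ 0`, whereas `D.boundary 0 ≠ D.boundary (1/2)`.
[folklore] -/
theorem carrier_diff_range_nonempty (D : JordanDomain) (γ : Curve ℂ)
    (hin : ∀ t : unitInterval, t ≠ 0 → γ t ∈ D.carrier) :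
    (D.carrier \ γ.range).Nonempty := by
  by_contra h
  rw [not_nonempty_iff_eq_empty, sdiff_eq_empty] at h
  have hcl : closure D.carrier ⊆ γ.range := closure_minimal h γ.isCompact_range.isClosed
  have hfr : frontier D.carrier ⊆ {γ 0} := fun z hz =>
    frontier_inter_range_subset_singleton D γ hin ⟨hz, hcl (frontier_subset_closure hz)⟩
  have h0 : D.boundary 0 = γ 0 := mem_singleton_iff.1 (hfr (D.boundary_mem_frontier 0))
  have h12 : D.boundary (1 / 2) = γ 0 :=
    mem_singleton_iff.1 (hfr (D.boundary_mem_frontier (1 / 2)))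
  have : (0 : ℝ) = 1 / 2 :=
    D.injOn_boundary ⟨le_refl _, one_pos⟩ ⟨by norm_num, by norm_num⟩ (h0.trans h12.symm)
  norm_num at this

/-- **An arc from the boundary does not separate a Jordan domain** (domain bookkeeping D1 of
the Markov clause). For a Jordan domain `D` and an injective curve `γ` with `γ 0 ∈ frontier D`
and `γ t ∈ D` for `t ≠ 0`, the slit domain `D ∖ γ[0, 1]` is connected. Janiszewski's theorem
(Pommerenke 1992, §1.1) applied to the boundary curve `J` and the arc `K = γ[0, 1]`, which meet
in the single point `γ 0`: points of `D ∖ K` are separated neither by `J` (they lie in the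
connected `D`) nor by `K` (a Jordan arc does not separate the plane), hence not by `J ∪ K`, and
the common complementary component of `J ∪ K` stays inside `D`. [folklore] -/
theorem stub_arcComplementConnected : ∀ (D : Literature.Probability.RandomPlanarGeometry.JordanDomain) (γ : Literature.Probability.RandomPlanarGeometry.Curve ℂ), Function.Injective γ → γ 0 ∈ frontier D.carrier → (∀ t : unitInterval, t ≠ 0 → γ t ∈ D.carrier) → IsConnected (D.carrier \ γ.range) := by
  intro D γ hγ _ hin
  obtain ⟨x, hxD, hxK⟩ := carrier_diff_range_nonempty D γ hin
  -- the boundary curve is compact (closed and bounded)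
  have hJc : IsCompact (frontier D.carrier) :=
    Metric.isCompact_of_isClosed_isBounded isClosed_frontier
      (D.isBounded.closure.subset frontier_subset_closure)
  have hKc : IsCompact γ.range := γ.isCompact_range
  have hJK : IsPreconnected (frontier D.carrier ∩ γ.range) :=
    (subsingleton_singleton.anti (frontier_inter_range_subset_singleton D γ hin)).isPreconnected
  have hDJ : D.carrier ⊆ (frontier D.carrier)ᶜ := carrier_subset_compl_frontier D
  have hxJK : x ∈ (frontier D.carrier ∪ γ.range)ᶜ := fun h => h.elim (hDJ hxD) hxK
  -- the component of `x` in the complement of `J ∪ K` stays inside `D ∖ K`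
  have hCsub :
      connectedComponentIn (frontier D.carrier ∪ γ.range)ᶜ x ⊆ D.carrier \ γ.range := by
    intro z hz
    have hz' : z ∈ (frontier D.carrier ∪ γ.range)ᶜ := connectedComponentIn_subset _ _ hz
    refine ⟨?_, fun h => hz' (Or.inr h)⟩
    by_contra hzD
    obtain ⟨w, hwC, hwJ⟩ := D.inter_frontier_nonempty_of_isPreconnected
      isPreconnected_connectedComponentIn ⟨x, mem_connectedComponentIn hxJK, hxD⟩
      ⟨z, hz, hzD⟩
    exact connectedComponentIn_subset _ _ hwC (Or.inl hwJ)
  -- and, by Janiszewski's theorem, contains every point of `D ∖ K`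
  have hsubC :
      D.carrier \ γ.range ⊆ connectedComponentIn (frontier D.carrier ∪ γ.range)ᶜ x := by
    rintro y ⟨hyD, hyK⟩
    refine janiszewski hJc hKc hJK ?_ ?_
    · exact D.isConnected.isPreconnected.subset_connectedComponentIn hxD hDJ hyD
    · exact (isConnected_compl_range_of_injective γ
        hγ).isPreconnected.subset_connectedComponentIn hxK Subset.rfl hyK
  rw [hsubC.antisymm hCsub]
  exact isConnected_connectedComponentIn_iff.2 hxJK

end Summit.CriticalPhenomena.SAWScalingLimit.Theorems.AxiomsOfLimitMarkov

end
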